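import Literature.Barriers.CriticalPhenomena.WeaklySAWRenormalisedParameters
import Literature.Barriers.CriticalPhenomena.WeaklySAWFieldSubstitution
import Literature.MathematicalPhysics.QuantumLattice.GrassmannIntegralSubstitution
import HarnessLib

/-!
# BBS 2015, §4.1, eq. (ExF): the supersymmetric change of variables `(φ,ψ) ↦ (1+z₀)^{1/2}(φ,ψ)` —
# `∫ F e^{-Σ_x(τ_{Δ,x}+gτ_x²+ντ_x)} = E_C F' e^{-V₀(Λ)}` for EVERY form `F`

Sequel to `WeaklySAWRenormalisedParameters.lean` (where (4.6)–(4.9) of Bauerschmidt–Brydges–Slade,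
CMP 337 (2015), arXiv:1403.7422 were obtained for the two-point observable through the Gauss–Fourier
representation). Here the source's own argument is formalised in full generality: substitutions in the
boson field act on the algebra of forms `𝒩` through their coefficients (the tree's
`GrassmannAlgebra.coeffMap`, change of the coefficient ring along `f ↦ f ∘ u`), rescaling of the fermion
field is the substitution of generators `ExteriorAlgebra.map (c·id)` (fermionic Jacobian `det = c^{2|Λ|}`,
`GrassmannAlgebra.berezin_map`), and for the simultaneous rescaling of both fields the bosonic Jacobian
`c^{-2|Λ|}` of Lebesgue measure on `ℂ^Λ ≅ ℝ^{2|Λ|}` cancels the fermionic one exactly — "there is no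
explicit Jacobian factor, since we also make the change of variables in the differentials `ψ, ψ̄`".

* (the substitutions in the boson field, `substForm u`, and translation invariance of `∫` are in
  `WeaklySAWFieldSubstitution.lean`);
* §"Scale": `genScale c` (`ψ ↦ cψ`), **`scaleForm c`** (`F ↦ F' = F(cφ, cψ)`, `c` real), its action
  `scaleForm_ofFun`, `scaleForm_psi`, `scaleForm_psiBar`, `scaleForm_tau` (`τ_x ↦ c²τ_x`),
  `scaleForm_fermionAction`, `scaleForm_superGauss` (`e^{-S_B} ↦ e^{-S_{c²B}}`), `scaleForm_interactionForm`
  (`e^{-Σ(gτ²+ντ)} ↦ e^{-Σ(c⁴g τ² + c²ν τ)}`); the top coefficient `berezin_scaleForm_apply`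
  (`[F']_{top}(φ) = c^{2|Λ|}[F]_{top}(cφ)`) and **`superIntegral_scaleForm`: `∫ F' = ∫ F`** (`c > 0`) — the
  supersymmetric cancellation of Jacobians.
* §"ExF": **`superIntegral_eq_scale`** (`∫ F e^{-S_A}e^{-Σ(gτ²+ντ)} = ∫ F' e^{-S_{c²A}}e^{-Σ(c⁴gτ²+c²ντ)}`,
  any `Λ`, any complex `A`) and, on the torus with `c² = 1+z₀`, `A = -Δ_Λ`, `C = (-Δ+m²)⁻¹`,
  **`superIntegral_eq_superExpectation_scaleForm`** = eq. (ExF) of §4.1: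
  `∫ F e^{-Σ_x(τ_{Δ,x}+gτ_x²+ντ_x)} = E_C(F' Z₀)`, `Z₀ = e^{-V₀(Λ)}`, `g = g₀/(1+z₀)²`, `ν = (ν₀+m²)/(1+z₀)`
  (`m² > 0`, `z₀ > -1`; every `g₀, ν₀`, every form `F`), together with its two-point instance
  `superIntegral_twoPoint_eq_GhatN` (`F = φ̄_aφ_b`, `F' = (1+z₀)φ̄_aφ_b`: eq. (4.6) at arbitrary sites).

Everything is proved; no named facts.

## References
* R. Bauerschmidt, D. C. Brydges, G. Slade, CMP 337 (2015), §4.1, eqs. (4.2)–(4.7) and the display (ExF)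
  with the sentence following it. [cite: BauerschmidtBrydgesSlade2015LogCorr]
* D. C. Brydges, J. Z. Imbrie, G. Slade, Probab. Surveys 6 (2009), §4.1 (forms, `ψ = (2πi)^{-1/2}dφ`, the
  integral of a form). [cite: BrydgesImbrieSlade2009]
-/

noncomputable section

open MeasureTheory Filter Topology Set Complex ComplexConjugate
open scoped ENNReal
open Literature.Probability.LatticeModels
open Literature.MathematicalPhysics.QuantumLattice
open Literature.MathematicalPhysics.QuantumLattice.GrassmannAlgebra (berezin gen coeffMap)
open scoped BigOperators

namespace Literature.Barriers.CriticalPhenomena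

namespace CTWSAW

/-! ### Rescaling both fields: `F ↦ F' = F(cφ, cψ)` -/

section Scale

variable {Λ : Type*} [Fintype Λ] [LinearOrder Λ]

/-- Rescaling of the fermionic generators `ψ_x, ψ̄_x ↦ cψ_x, cψ̄_x` (an algebra endomorphism over the
`0`-forms). [folklore] -/
def genScale (c : ℝ) : SForm Λ →ₐ[FieldFun Λ] SForm Λ :=
  ExteriorAlgebra.map ((constFun (c : ℂ) : FieldFun Λ) •
    (LinearMap.id : ((Λ ⊕ₗ Λ) → FieldFun Λ) →ₗ[FieldFun Λ] ((Λ ⊕ₗ Λ) → FieldFun Λ)))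

omit [Fintype Λ] in
/-- `genScale` multiplies each generator by `c`. [folklore] -/
theorem genScale_gen (c : ℝ) (j : Λ ⊕ₗ Λ) :
    genScale c (gen (FieldFun Λ) j) = (constFun (c : ℂ) : FieldFun Λ) • gen (FieldFun Λ) j := by
  rw [genScale, gen, ExteriorAlgebra.map_apply_ι, LinearMap.smul_apply, LinearMap.id_apply, map_smul]

omit [Fintype Λ] [LinearOrder Λ] in
/-- `genScale` fixes the `0`-forms. [folklore] -/
theorem genScale_ofFun (c : ℝ) (f : FieldFun Λ) : genScale c (ofFun f) = (ofFun f : SForm Λ) := by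
  unfold ofFun; exact AlgHom.commutes _ f

/-- **The rescaling `(φ, ψ) ↦ (cφ, cψ)` of both fields** (`c` real), `F ↦ F'`, `F'(φ,ψ) = F(cφ, cψ)`: the
substitution `φ ↦ cφ` in the coefficients followed by `ψ ↦ cψ` on the generators; a ring endomorphism of
the algebra of forms. [cite: BauerschmidtBrydgesSlade2015LogCorr, §4.1 ("set (φ',ψ') = ((1+z₀)^{1/2}φ, (1+z₀)^{1/2}ψ) and similarly for the conjugates"; "writing F'(φ,ψ) = F(φ',ψ')")] -/
def scaleForm (c : ℝ) : SForm Λ →+* SForm Λ where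
  toFun K := genScale c (substForm (fun φ => c • φ) K)
  map_one' := by simp
  map_mul' x y := by simp
  map_zero' := by simp
  map_add' x y := by simp

/-- Unfolding `scaleForm`. [folklore] -/
theorem scaleForm_apply (c : ℝ) (K : SForm Λ) : scaleForm c K = genScale c (substForm (fun φ => c • φ) K) := rfl

/-- `F ↦ F'` on `0`-forms: `f(φ) ↦ f(cφ)`. [folklore] -/
theorem scaleForm_ofFun (c : ℝ) (f : FieldFun Λ) : scaleForm c (ofFun f) = ofFun (fun φ => f (c • φ)) := by
  rw [scaleForm_apply, substForm_ofFun, genScale_ofFun]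

/-- `F ↦ F'` on `ψ_x`: `ψ_x ↦ cψ_x`. [folklore] -/
theorem scaleForm_psi (c : ℝ) (x : Λ) :
    scaleForm c (psi (FieldFun Λ) x) = ofFun (constFun (c : ℂ)) * psi (FieldFun Λ) x := by
  rw [scaleForm_apply, substForm_psi, psi, genScale_gen, ofFun_mul]

/-- `F ↦ F'` on `ψ̄_x`: `ψ̄_x ↦ cψ̄_x`. [folklore] -/
theorem scaleForm_psiBar (c : ℝ) (x : Λ) :
    scaleForm c (psiBar (FieldFun Λ) x) = ofFun (constFun (c : ℂ)) * psiBar (FieldFun Λ) x := by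
  rw [scaleForm_apply, substForm_psiBar, psiBar, genScale_gen, ofFun_mul]

/-- `F ↦ F'` is semilinear over the `0`-forms. [folklore] -/
theorem scaleForm_smul (c : ℝ) (f : FieldFun Λ) (K : SForm Λ) :
    scaleForm c (f • K) = fieldPrecomp (fun φ => c • φ) f • scaleForm c K := by
  rw [scaleForm_apply, substForm_smul, map_smul, scaleForm_apply]

/-- `(cψ_x)(cψ̄_y) = c²ψ_xψ̄_y`. [folklore] -/
theorem scaleForm_psi_mul_psiBar (c : ℝ) (x y : Λ) :
    scaleForm c (psi (FieldFun Λ) x * psiBar (FieldFun Λ) y) =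
      ofFun (constFun ((c : ℂ) ^ 2)) * (psi (FieldFun Λ) x * psiBar (FieldFun Λ) y) := by
  rw [map_mul, scaleForm_psi, scaleForm_psiBar, mul_assoc, ← mul_assoc (psi _ x) (ofFun _) _, ← ofFun_comm,
    mul_assoc, ← mul_assoc, ofFun_mul_ofFun]
  congr 2
  funext φ; simp [constFun, sq]

/-- `(cψ̄_x)(cψ_y) = c²ψ̄_xψ_y`. [folklore] -/
theorem scaleForm_psiBar_mul_psi (c : ℝ) (x y : Λ) :
    scaleForm c (psiBar (FieldFun Λ) x * psi (FieldFun Λ) y) =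
      ofFun (constFun ((c : ℂ) ^ 2)) * (psiBar (FieldFun Λ) x * psi (FieldFun Λ) y) := by
  rw [map_mul, scaleForm_psi, scaleForm_psiBar, mul_assoc, ← mul_assoc (psiBar _ x) (ofFun _) _, ← ofFun_comm,
    mul_assoc, ← mul_assoc, ofFun_mul_ofFun]
  congr 2
  funext φ; simp [constFun, sq]

/-- **`τ_x(φ', ψ') = c²τ_x(φ, ψ)`** (so `V_{g,ν,1}(φ',ψ')` rescales as in (4.2)). [cite: BauerschmidtBrydgesSlade2015LogCorr, §4.1, eq. (4.2)] -/
theorem scaleForm_tau (c : ℝ) (x : Λ) : scaleForm c (tau x) = ofFun (constFun ((c : ℂ) ^ 2)) * tau x := by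
  rw [tau, map_add, scaleForm_ofFun, scaleForm_psi_mul_psiBar, mul_add, ofFun_mul_ofFun]
  congr 2
  funext φ
  simp only [Pi.mul_apply, constFun, real_smul_apply, map_mul, Complex.conj_ofReal]
  ring

/-- `ψ(B)ψ̄(φ',ψ') = ψ(c²B)ψ̄`. [folklore] -/
theorem scaleForm_fermionAction (c : ℝ) (B : Matrix Λ Λ ℂ) :
    scaleForm c (fermionAction B) = fermionAction (((c : ℂ) ^ 2) • B) := by
  rw [fermionAction_smul, fermionAction, Finset.mul_sum, map_sum]
  refine Finset.sum_congr rfl fun x _ => ?_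
  rw [Finset.mul_sum, map_sum]
  refine Finset.sum_congr rfl fun y _ => ?_
  rw [scaleForm_smul, fieldPrecomp_constFun, scaleForm_psi_mul_psiBar, mul_smul_comm]

omit [LinearOrder Λ] in
/-- `φ'Bφ̄' = c²·φBφ̄`. [folklore] -/
theorem quadForm_real_smul (B : Matrix Λ Λ ℂ) (c : ℝ) (φ : Λ → ℂ) :
    Boson.quadForm B (c • φ) = (c : ℂ) ^ 2 * Boson.quadForm B φ := by
  unfold Boson.quadForm
  rw [Finset.mul_sum]
  refine Finset.sum_congr rfl fun x _ => ?_
  rw [Finset.mul_sum]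
  refine Finset.sum_congr rfl fun y _ => ?_
  rw [real_smul_apply, real_smul_apply, map_mul, Complex.conj_ofReal]
  ring

/-- **`e^{-S_B}(φ',ψ') = e^{-S_{c²B}}(φ,ψ)`**. [cite: BauerschmidtBrydgesSlade2015LogCorr, §4.1, eq. (4.2) (V_{0,m²,1} and z₀τ_Δ under the rescaling)] -/
theorem scaleForm_superGauss (c : ℝ) (B : Matrix Λ Λ ℂ) :
    scaleForm c (superGauss B) = superGauss (((c : ℂ) ^ 2) • B) := by
  have hnil : IsNilpotent (-fermionAction B) := by
    rw [fermionAction_eq_neg_quadratic, neg_neg]; exact isNilpotent_quadratic _ _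
  rw [superGauss, superGauss, map_mul, scaleForm_ofFun, grassmannExp, hnil.map_exp (scaleForm c), ← grassmannExp,
    map_neg, scaleForm_fermionAction]
  congr 2
  funext φ
  rw [Boson.gaussWeight, Boson.gaussWeight, quadForm_real_smul, quadForm_smul]

/-- `ψ̄_xψ_x(φ',ψ') = c²ψ̄_xψ_x`. [folklore] -/
theorem scaleForm_pairBar (c : ℝ) (x : Λ) : scaleForm c (pairBar x) = ofFun (constFun ((c : ℂ) ^ 2)) * pairBar x :=
  scaleForm_psiBar_mul_psi c x x

omit [Fintype Λ] [LinearOrder Λ] in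
/-- `‖(cφ)_x‖ ^ 2 = c²‖φ_x‖²`. [folklore] -/
theorem norm_real_smul_apply_sq (c : ℝ) (φ : Λ → ℂ) (x : Λ) : ‖(c • φ) x‖ ^ 2 = c ^ 2 * ‖φ x‖ ^ 2 := by
  rw [real_smul_apply, norm_mul, Complex.norm_real, Real.norm_eq_abs, mul_pow, sq_abs]

/-- **`e^{-Σ(gτ²+ντ)}(φ',ψ') = e^{-Σ(c⁴g τ² + c²ν τ)}(φ,ψ)`** (`g₀ = g(1+z₀)²`, `(1+z₀)ν`).
[cite: BauerschmidtBrydgesSlade2015LogCorr, §4.1, eqs. (4.2)–(4.3) (g₀ = g(1+z₀)², ν₀ = (1+z₀)ν - m²)] -/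
theorem scaleForm_interactionForm (c g ν : ℝ) :
    scaleForm c (interactionForm g ν) = (interactionForm (c ^ 4 * g) (c ^ 2 * ν) : SForm Λ) := by
  rw [interactionForm, interactionForm, map_mul, scaleForm_ofFun, grassmannExp,
    (isNilpotent_quadratic _ _).map_exp (scaleForm c), ← grassmannExp, quadratic_diagonal, quadratic_diagonal, map_sum]
  have hsq : ∀ φ : Λ → ℂ, ∀ x, ‖(c • φ) x‖ ^ 4 = c ^ 4 * ‖φ x‖ ^ 4 := by
    intro φ x
    rw [show (4 : ℕ) = 2 * 2 from rfl, pow_mul, pow_mul, pow_mul, norm_real_smul_apply_sq, mul_pow]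
  congr 2
  · funext φ
    congr 2
    refine Finset.sum_congr rfl fun x _ => ?_
    simp only [interactionScalar, hsq, norm_real_smul_apply_sq]
    push_cast; ring
  · refine Finset.sum_congr rfl fun x _ => ?_
    rw [scaleForm_smul, scaleForm_pairBar, ofFun_mul, smul_smul]
    congr 1
    funext φ
    simp only [Pi.mul_apply, fieldPrecomp_apply, interactionCoeff, constFun, norm_real_smul_apply_sq]
    push_cast; ring

/-! #### The Jacobians cancel -/

omit [LinearOrder Λ] in
/-- `|Λ ⊔ Λ| = 2|Λ|` (the number of fermionic generators). [folklore] -/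
theorem card_lex_sum : Fintype.card (Λ ⊕ₗ Λ) = 2 * Fintype.card Λ := by
  rw [← Fintype.card_congr (toLex (α := Λ ⊕ Λ)), Fintype.card_sum]; ring

omit [LinearOrder Λ] in
/-- The fermionic Jacobian of `ψ ↦ cψ` is `c^{2|Λ|}`. [folklore] -/
theorem det_genScaleMap (c : ℝ) :
    LinearMap.det ((constFun (c : ℂ) : FieldFun Λ) •
      (LinearMap.id : ((Λ ⊕ₗ Λ) → FieldFun Λ) →ₗ[FieldFun Λ] ((Λ ⊕ₗ Λ) → FieldFun Λ))) =
      (constFun (c : ℂ)) ^ (2 * Fintype.card Λ) := by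
  rw [LinearMap.det_smul, LinearMap.det_id, mul_one, Module.finrank_fintype_fun_eq_card, card_lex_sum]

/-- `∫dψ̄dψ F(φ, cψ) = c^{2|Λ|} ∫dψ̄dψ F(φ, ψ)` (`berezin_map`: the fermionic Jacobian enters directly). [folklore] -/
theorem berezin_genScale (c : ℝ) (K : SForm Λ) :
    berezin (FieldFun Λ) (Λ ⊕ₗ Λ) (genScale c K) =
      (constFun (c : ℂ)) ^ (2 * Fintype.card Λ) * berezin (FieldFun Λ) (Λ ⊕ₗ Λ) K := by
  rw [genScale, GrassmannAlgebra.berezin_map, det_genScaleMap]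

/-- **Top coefficient of the rescaled form**: `[F']_{top}(φ) = c^{2|Λ|}·[F]_{top}(cφ)`. [folklore] -/
theorem berezin_scaleForm_apply (c : ℝ) (K : SForm Λ) (φ : Λ → ℂ) :
    berezin (FieldFun Λ) (Λ ⊕ₗ Λ) (scaleForm c K) φ =
      (c : ℂ) ^ (2 * Fintype.card Λ) * berezin (FieldFun Λ) (Λ ⊕ₗ Λ) K (c • φ) := by
  rw [scaleForm_apply, berezin_genScale, Pi.mul_apply, Pi.pow_apply, berezin_substForm_apply]
  rfl

omit [LinearOrder Λ] in
/-- `dim_ℝ ℂ^Λ = 2|Λ|`. [folklore] -/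
theorem finrank_real_field : Module.finrank ℝ (Λ → ℂ) = 2 * Fintype.card Λ := by
  rw [Module.finrank_pi_fintype, Complex.finrank_real_complex, Finset.sum_const, Finset.card_univ, smul_eq_mul,
    mul_comm]

/-- **The Jacobians cancel: `∫ F' = ∫ F`** for the simultaneous rescaling `(φ,ψ) ↦ (cφ, cψ)`, `c > 0` — the
fermionic Jacobian `c^{2|Λ|}` (`berezin_scaleForm_apply`) against the bosonic `c^{-2|Λ|}` of
`dφ̄dφ` on `ℂ^Λ`. [cite: BauerschmidtBrydgesSlade2015LogCorr, §4.1 ("There is no explicit Jacobian factor, since we also make the change of variables in the differentials ψ, ψ̄")] -/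
theorem superIntegral_scaleForm {c : ℝ} (hc : 0 < c) (K : SForm Λ) :
    superIntegral (scaleForm c K) = superIntegral K := by
  have hc0 : (c : ℂ) ≠ 0 := by exact_mod_cast hc.ne'
  have h := Measure.integral_comp_smul volume (fun φ => berezin (FieldFun Λ) (Λ ⊕ₗ Λ) K φ) c
  unfold superIntegral
  congr 1
  simp_rw [berezin_scaleForm_apply]
  rw [integral_const_mul, h, finrank_real_field, abs_of_pos (by positivity), Complex.real_smul, ← mul_assoc,
    Complex.ofReal_inv, Complex.ofReal_pow, mul_inv_cancel₀ (pow_ne_zero _ hc0), one_mul]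

/-- `∫ (z·1) K = z ∫ K` for a complex constant. [folklore] -/
theorem superIntegral_constFun_mul (z : ℂ) (K : SForm Λ) :
    superIntegral (ofFun (constFun z) * K) = z * superIntegral K := by
  unfold superIntegral
  simp_rw [berezin_ofFun_mul, Pi.mul_apply, constFun, integral_const_mul]
  ring

end Scale

/-! ### Eq. (ExF): `∫ F e^{-Σ(τ_Δ+gτ²+ντ)} = E_C F' e^{-V₀(Λ)}` -/

section ExF

variable {Λ : Type*} [Fintype Λ] [LinearOrder Λ]

/-- **The rescaled integral**, any `Λ`, any complex `A`: for `c > 0` and every form `F`,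
`∫ F e^{-S_A}e^{-Σ(gτ²+ντ)} = ∫ F' e^{-S_{c²A}}e^{-Σ(c⁴g τ² + c²ν τ)}`, `F' = F(cφ,cψ)`. [cite: BauerschmidtBrydgesSlade2015LogCorr, §4.1, eqs. (4.2) and (ExF)] -/
theorem superIntegral_eq_scale {c : ℝ} (hc : 0 < c) (F : SForm Λ) (A : Matrix Λ Λ ℂ) (g ν : ℝ) :
    superIntegral (F * (superGauss A * interactionForm g ν)) =
      superIntegral (scaleForm c F * (superGauss (((c : ℂ) ^ 2) • A) * interactionForm (c ^ 4 * g) (c ^ 2 * ν))) := by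
  rw [← superIntegral_scaleForm hc (F * _), map_mul, map_mul, scaleForm_superGauss, scaleForm_interactionForm]

/-- `F ↦ F'` on the two-point observable: `φ̄_aφ_b ↦ c²φ̄_aφ_b`. [folklore] -/
theorem scaleForm_ofFun_twoPoint (c : ℝ) (a b : Λ) :
    scaleForm c (ofFun fun φ => φ b * conj (φ a)) =
      ofFun (constFun ((c : ℂ) ^ 2)) * ofFun (fun φ : Λ → ℂ => φ b * conj (φ a)) := by
  rw [scaleForm_ofFun, ofFun_mul_ofFun]
  congr 1
  funext φ
  simp only [Pi.mul_apply, constFun, real_smul_apply, map_mul, Complex.conj_ofReal]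
  ring

variable {d n : ℕ} [NeZero n]

attribute [-instance] Fintype.decidablePiFintype

/-- **BBS 2015, §4.1, eq. (ExF)** on the torus `Λ = ℤ^d/nℤ^d`: for `m² > 0`, `z₀ > -1`, every `g₀, ν₀` and
EVERY form `F`, with `g = g₀/(1+z₀)²`, `ν = (ν₀+m²)/(1+z₀)`, `C = (-Δ+m²)⁻¹`, `Z₀ = e^{-V₀(Λ)}` and
`F' = F((1+z₀)^{1/2}φ, (1+z₀)^{1/2}ψ)`:
`∫ F e^{-Σ_x(τ_{Δ,x}+gτ_x²+ντ_x)} = E_C(F' Z₀)` — the rescaling of both fields (`superIntegral_eq_scale`,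
no Jacobian) followed by `V_{g,ν,1}(φ',ψ') = V_{0,m²,1}(φ,ψ) + V_{g₀,ν₀,z₀}(φ,ψ)` ((4.2), in the form
`e^{-S_{(1+z₀)(-Δ)}}e^{-Σ(g₀τ²+(ν₀+m²)τ)} = e^{-S_{-Δ+m²}}·Z₀`). [cite: BauerschmidtBrydgesSlade2015LogCorr, §4.1, eqs. (4.2)–(4.5) and (ExF)] -/
theorem superIntegral_eq_superExpectation_scaleForm {m2 : ℝ} (hm : 0 < m2) (g₀ ν₀ : ℝ) {z₀ : ℝ}
    (hz : -1 < z₀) (F : SForm (TorusSite d n)) :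
    superIntegral (F * (superGauss (negLaplacianC d n) *
        interactionForm (g₀ / (1 + z₀) ^ 2) ((ν₀ + m2) / (1 + z₀)))) =
      superExpectation (freeCovariance d n m2) (scaleForm (Real.sqrt (1 + z₀)) F * boltzmannZ0 g₀ ν₀ z₀) := by
  have hs : 0 < 1 + z₀ := by linarith
  set c : ℝ := Real.sqrt (1 + z₀) with hc_def
  have hc : 0 < c := Real.sqrt_pos.2 hs
  have hc2 : c ^ 2 = 1 + z₀ := Real.sq_sqrt hs.le
  have hc4 : c ^ 4 = (1 + z₀) ^ 2 := by rw [show (4 : ℕ) = 2 * 2 from rfl, pow_mul, hc2]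
  have h1 : c ^ 4 * (g₀ / (1 + z₀) ^ 2) = g₀ := by rw [hc4]; field_simp
  have h2 : c ^ 2 * ((ν₀ + m2) / (1 + z₀)) = ν₀ + m2 := by rw [hc2]; field_simp
  have h3 : ((c : ℂ) ^ 2) = (((1 + z₀ : ℝ)) : ℂ) := by rw [← Complex.ofReal_pow, hc2]
  rw [superIntegral_eq_scale hc, h1, h2, h3, superExpectation_freeCovariance hm]
  congr 1
  rw [boltzmannZ0, ← mul_assoc (superGauss (massLaplacianC d n m2)),
    (commute_superGauss (massLaplacianC d n m2) _).eq, mul_assoc (scaleForm c F),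
    ← mul_assoc (superGauss (massLaplacianC d n m2)), massLaplacianC, superGauss_mul_superGauss,
    show negLaplacianC d n + Matrix.diagonal (fun _ => (m2 : ℂ)) + (z₀ : ℂ) • negLaplacianC d n =
      (((1 + z₀ : ℝ)) : ℂ) • negLaplacianC d n + Matrix.diagonal (fun _ => (m2 : ℂ)) by
        push_cast; rw [add_smul, one_smul]; abel,
    superGauss_add_diagonal_mul_interactionForm]

/-- **Eq. (4.6) at arbitrary sites, from (ExF)**: with `F = φ̄_aφ_b`, `F' = (1+z₀)φ̄_aφ_b`, so
`∫ e^{-Σ(τ_Δ+gτ²+ντ)} φ̄_aφ_b = (1+z₀) E_C(Z₀ φ̄_aφ_b) = (1+z₀) Ĝ_N(m²,g₀,ν₀,z₀; a,b)` (`m² > 0`, `z₀ > -1`,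
every `g₀, ν₀, a, b`). [cite: BauerschmidtBrydgesSlade2015LogCorr, §4.1, eqs. (4.6)–(4.7) ("Then, by (ExF), G_N(g,ν) = (1+z₀)Ĝ_N(m²,g₀,ν₀,z₀)")] -/
theorem superIntegral_twoPoint_eq_GhatN {m2 : ℝ} (hm : 0 < m2) (g₀ ν₀ : ℝ) {z₀ : ℝ} (hz : -1 < z₀)
    (a b : TorusSite d n) :
    superIntegral (ofFun (fun φ => φ b * conj (φ a)) * (superGauss (negLaplacianC d n) *
        interactionForm (g₀ / (1 + z₀) ^ 2) ((ν₀ + m2) / (1 + z₀)))) =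
      (((1 + z₀ : ℝ)) : ℂ) * GhatN d n m2 g₀ ν₀ z₀ a b := by
  have hs : 0 < 1 + z₀ := by linarith
  rw [superIntegral_eq_superExpectation_scaleForm hm g₀ ν₀ hz, scaleForm_ofFun_twoPoint, ← Complex.ofReal_pow,
    Real.sq_sqrt hs.le, GhatN,
    show (fun φ : TorusSite d n → ℂ => conj (φ a) * φ b) = fun φ => φ b * conj (φ a) from
      funext fun _ => mul_comm _ _, superExpectation, superExpectation]
  have hcomm : superGauss (freeCovariance d n m2)⁻¹ *
      (ofFun (constFun (((1 + z₀ : ℝ)) : ℂ)) * ofFun (fun φ : TorusSite d n → ℂ => φ b * conj (φ a)) *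
        boltzmannZ0 g₀ ν₀ z₀) =
      ofFun (constFun (((1 + z₀ : ℝ)) : ℂ)) * (superGauss (freeCovariance d n m2)⁻¹ *
        (boltzmannZ0 g₀ ν₀ z₀ * ofFun (fun φ : TorusSite d n → ℂ => φ b * conj (φ a)))) := by
    rw [mul_assoc (ofFun _) (ofFun _) (boltzmannZ0 _ _ _), ← mul_assoc (superGauss _) (ofFun (constFun _)),
      (commute_superGauss _ (ofFun (constFun _))).eq, mul_assoc (ofFun (constFun _)), ofFun_comm _ (boltzmannZ0 _ _ _)]
  rw [hcomm, superIntegral_constFun_mul]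

end ExF

end CTWSAW

end Literature.Barriers.CriticalPhenomena
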